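import Literature.NumberTheory.CubicFields.ThreeTorsionSumFirstOrder
import Literature.NumberTheory.CubicFields.DavenportHeilbronnSieve
import Literature.NumberTheory.CubicFields.UniformityEstimate
import Literature.NumberTheory.CubicFields.IrreducibleNondegenerate
import Literature.NumberTheory.CubicFields.MaximalOverring
import Literature.NumberTheory.QuadraticFields.LocalFundamental
import Literature.NumberTheory.QuadraticFields.ThreeTorsionMeanSquarefreeEuler
import HarnessLib

/-!
# BST §8.5, step 2 ("by the same argument as in the proof of Theorem 1"): the sieve to fundamental discriminants, from finite-level counts and the uniformity estimate

Topic `Literature/NumberTheory/CubicFields`, continuing `ThreeTorsionSumFirstOrder.lean` (which reduces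
the named fact `davenportHeilbronn_threeTorsion_sum_asymp` — Davenport–Heilbronn's first-order mean of
`#Cl₃` over quadratic fields, Bhargava–Shankar–Tsimerman Cor. 7 — to the class-field-theory dictionary
and the orbit count `Σ_{0<±D<X fund.} #irredOrbitsOfDisc D ~ 3X/(nᵢπ²)`).

Bhargava–Shankar–Tsimerman arXiv:1005.0672, §8.5: "Let `𝒱 = ∩_p 𝒱_p` be the set of all `v ∈ V_ℤ`
corresponding to maximal cubic rings that are nowhere totally ramified … `μ(𝒱_p) = (1 − p⁻²)²`. By the
same argument as in the proof of the main term of Theorem 1,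
`lim_{X→∞} N(𝒱 ∩ V^{(i)}; X)/X = (π²/(12nᵢ)) ∏_p (1 − p⁻²)² = 3/(nᵢπ²)`", the argument of §8.3 being:
the finite-level counting theorem `lim N(∩_{p<Y} 𝒱_p ∩ V^{(i)}; X)/X = (π²/(12nᵢ)) ∏_{p<Y} μ(𝒱_p)`
((ramanujan) = Thm 20 with Lemma 13), the uniformity estimate `N(𝒵_p; X) = O(X/p²)` (Prop. 23,
`𝒵_p = V_ℤ − 𝒱_p` "those binary cubic forms whose discriminants are not fundamental" at `p`), and the
limsup/liminf sieve letting `Y → ∞`. With `𝒱_p` spelled as the LOCAL FUNDAMENTALITY of the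
discriminant (`QuadraticFields.IsFundAt p`, `LocalFundamental.lean`; BST §8.2) this file PROVES that
argument on the tree's objects, the sieve being the tree's abstract
`DavenportHeilbronnSieve.tendsto_count_iInter_prime_div`:

* `irredOrbitCount s S X` — BST's `N(S ∩ V^{(i)}; X)`: the number of `GL₂(ℤ)`-orbits of irreducible
  integral binary cubic forms `f ∈ S` with `0 < s·Disc f < X` (`s = −1`: `i = 1`; `s = 1`: `i = 0`);
  finiteness, monotonicity, subadditivity; decomposition of orbit sets by discriminant
  (`ncard_orbits_disc_mem_eq_sum`);
* `irredOrbitCount_fund_eq_sum_negFundDiscrs` / `…_posFundDiscrs` — **`N(𝒱 ∩ V^{(i)}; X) =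
  Σ_{D ∈ negFundDiscrs X / posFundDiscrs X} #irredOrbitsOfDisc D`** (fundamental ⟺ locally fundamental at
  every prime and `≠ 1`; an irreducible form has `|Disc| > 2`, Minkowski);
* `irredOrbitCount_compl_isFundAt_le` — **Prop. 23 from the tree's uniformity fact**: a form not locally
  fundamental at `p` has `p² ∣ Disc` (`Disc ≡ 0, 1 (mod 4)` at `p = 2`), so `N(𝒵_p ∩ V^{(i)}; X)` is at
  most the number of ALL orbits with `p² ∣ Disc` in the window, bounded by `btt_uniformity_sqDvd`
  (BTT Prop. 4.5 at `q = p`: `≤ 6C X/p²`);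
* **`tendsto_irredOrbitCount_fund_div`** — the sieve: if for every `Y`
  `N(∩_{p<Y} 𝒱_p ∩ V^{(i)}; X)/X → c · ∏_{p<Y} (1 − p⁻²)²` (the finite-level Davenport count, HYPOTHESIS)
  and `btt_uniformity_sqDvd` holds, then `N(𝒱 ∩ V^{(i)}; X)/X → c · (6/π²)²`
  (`∏_p (1 − p⁻²) = 6/π²`, `hasProd_one_sub_one_div_prime_sq`);
* **`davenportHeilbronn_threeTorsion_sum_asymp_of_level_counts`** — hence the named fact follows from:
  the dictionary (`threeTorsion_eq_two_mul_cubicFieldCountOfDisc_add_one`), the uniformity fact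
  (`btt_uniformity_sqDvd`), and the finite-level counts with `c = π²/24` (`D < 0`, `n₁ = 2`) and
  `c = π²/72` (`D > 0`, `n₀ = 6`): `(π²/24)(36/π⁴) = 3/(2π²)`, `(π²/72)(36/π⁴) = 1/(2π²)`.

NOT here (the one remaining analytic input, not restated as a fact): the finite-level counts themselves —
Davenport's theorem with congruence conditions, BST Thm 17 + Thm 20 (cong) (`N(S ∩ V^{(i)}; X) =
(π²/(12nᵢ)) ∏_p μ_p(S) X + o(X)` for `S` defined by finitely many congruence conditions) together with the
`p`-adic densities `μ(𝒱_p) = (1 − p⁻²)²` (Lemma 13).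

## References

* M. Bhargava, A. Shankar, J. Tsimerman, *On the Davenport–Heilbronn theorems and second order
  terms*, Invent. Math. 193 (2013) 439–499 = arXiv:1005.0672, §8.2 (Prop. 23), §8.3 (proof of Thm 1),
  §8.5 (proof of Cor. 7), Lemma 13, Thms 17, 20 [BhargavaShankarTsimerman2012].
* M. Bhargava, T. Taniguchi, F. Thorne, Math. Ann. 389 (2024) = arXiv:2107.12819, Prop. 4.5
  [BhargavaTaniguchiThorne2023].
* H. Davenport, H. Heilbronn, Proc. Roy. Soc. London A 322 (1971) 405–420, §5 [DavenportHeilbronn1971].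
-/

noncomputable section

open Filter Finset
open scoped Topology

namespace Literature.NumberTheory.CubicFields

open NumberField BinaryCubic RingOfForm Literature.NumberTheory.QuadraticFields

/-! ### Orbit sets cut out by a condition on the discriminant -/

/-- The `GL₂(ℤ)`-orbits of forms `f` with `P f` and `Disc f ∈ F`. [folklore] -/
def orbitsWith (P : BinaryCubic ℤ → Prop) (F : Set ℤ) : Set (Set (BinaryCubic ℤ)) :=
  {O | ∃ f : BinaryCubic ℤ, O = gl2zOrbit f ∧ P f ∧ f.disc ∈ F}

/-- Monotone in the predicate and in the set of discriminants. [folklore] -/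
theorem orbitsWith_mono {P Q : BinaryCubic ℤ → Prop} (hPQ : ∀ f, P f → Q f) {F G : Set ℤ} (hFG : F ⊆ G) :
    orbitsWith P F ⊆ orbitsWith Q G := by
  rintro O ⟨f, rfl, hP, hF⟩
  exact ⟨f, rfl, hPQ f hP, hFG hF⟩

/-- With the trivial predicate and one discriminant these are the orbits of discriminant `D`. [folklore] -/
theorem orbitsWith_true_singleton (D : ℤ) : orbitsWith (fun _ => True) {D} = orbitsOfDisc D := by
  ext O
  simp only [orbitsWith, orbitsOfDisc, Set.mem_singleton_iff, true_and, Set.mem_setOf_eq]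

/-- With the predicate "irreducible" and one discriminant: `irredOrbitsOfDisc D`. [folklore] -/
theorem orbitsWith_isIrreducible_singleton (D : ℤ) : orbitsWith BinaryCubic.IsIrreducible {D} = irredOrbitsOfDisc D := by
  ext O
  simp only [orbitsWith, irredOrbitsOfDisc, Set.mem_singleton_iff, Set.mem_setOf_eq]

/-- Finiteness: finitely many orbits have discriminant in a finite set of nonzero integers (Hermite /
`orbitsOfDisc_finite`). [folklore] -/
theorem orbitsWith_finite (P : BinaryCubic ℤ → Prop) {F : Set ℤ} (hF : F.Finite) (h0 : (0 : ℤ) ∉ F) :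
    (orbitsWith P F).Finite := by
  refine (hF.biUnion fun D hD => orbitsOfDisc_finite (fun h => h0 (h ▸ hD))).subset ?_
  rintro O ⟨f, rfl, -, hfF⟩
  exact Set.mem_biUnion hfF ⟨f, rfl, rfl⟩

/-- Orbits with discriminant in a disjoint union: `orbitsWith P (insert D F) = orbitsWith P {D} ∪ orbitsWith P F`. [folklore] -/
theorem orbitsWith_insert (P : BinaryCubic ℤ → Prop) (D : ℤ) (F : Set ℤ) :
    orbitsWith P (insert D F) = orbitsWith P {D} ∪ orbitsWith P F := by
  ext O
  constructor
  · rintro ⟨f, rfl, hP, hF⟩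
    rcases hF with rfl | hF
    · exact Or.inl ⟨f, rfl, hP, rfl⟩
    · exact Or.inr ⟨f, rfl, hP, hF⟩
  · rintro (⟨f, rfl, hP, hF⟩ | ⟨f, rfl, hP, hF⟩)
    · rw [Set.mem_singleton_iff] at hF
      exact ⟨f, rfl, hP, hF ▸ Set.mem_insert _ _⟩
    · exact ⟨f, rfl, hP, Set.mem_insert_of_mem _ hF⟩

/-- An orbit determines the discriminant, so orbit sets over disjoint sets of discriminants are disjoint. [folklore] -/
theorem disjoint_orbitsWith (P : BinaryCubic ℤ → Prop) {D : ℤ} {F : Set ℤ} (hD : D ∉ F) :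
    Disjoint (orbitsWith P {D}) (orbitsWith P F) := by
  rw [Set.disjoint_left]
  rintro O ⟨f, rfl, -, hf⟩ ⟨g, hfg, -, hg⟩
  rw [Set.mem_singleton_iff] at hf
  have h : GL2ZEquiv f g := gl2zOrbit_eq_iff.mp hfg
  apply hD
  rw [← hf, ← h.disc_eq]
  exact hg

/-- **Decomposition of an orbit count by discriminant**: for a finite set `F` of nonzero integers,
`#orbitsWith P F = Σ_{D ∈ F} #orbitsWith P {D}`. [folklore] -/
theorem ncard_orbitsWith_eq_sum (P : BinaryCubic ℤ → Prop) (F : Finset ℤ) (h0 : (0 : ℤ) ∉ F) :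
    (orbitsWith P (F : Set ℤ)).ncard = ∑ D ∈ F, (orbitsWith P {D}).ncard := by
  classical
  induction F using Finset.induction_on with
  | empty =>
    rw [Finset.sum_empty, Finset.coe_empty]
    have : orbitsWith P (∅ : Set ℤ) = ∅ := by
      ext O; simp [orbitsWith]
    rw [this, Set.ncard_empty]
  | insert D F hDF ih =>
    have h0D : (0 : ℤ) ≠ D := fun h => h0 (h ▸ Finset.mem_insert_self D F)
    have h0F : (0 : ℤ) ∉ F := fun h => h0 (Finset.mem_insert_of_mem h)
    rw [Finset.sum_insert hDF, Finset.coe_insert, orbitsWith_insert, ← ih h0F]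
    refine Set.ncard_union_eq (disjoint_orbitsWith P (by exact_mod_cast hDF)) ?_ ?_
    · exact orbitsWith_finite P (Set.finite_singleton D) (by simpa using h0D)
    · exact orbitsWith_finite P F.finite_toSet (by exact_mod_cast h0F)

/-! ### `N(S ∩ V^{(i)}; X)` -/

/-- **BST's counting function `N(S ∩ V^{(i)}; X)`**: the number of `GL₂(ℤ)`-orbits of irreducible
integral binary cubic forms `f ∈ S` with `0 < s · Disc f < X` (`s = −1` for `V^{(1)}`, negative
discriminants; `s = 1` for `V^{(0)}`). For `GL₂(ℤ)`-invariant `S` this is literally BST's "number of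
irreducible `GL₂(ℤ)`-orbits in `S` with `|Disc| < X`"; for general `S`, orbits meeting `S`.
[cite: BhargavaShankarTsimerman2012, §5 (N(S; X), the number of irreducible GL₂(ℤ)-orbits in S with |Disc| < X)] -/
def irredOrbitCount (s : ℤ) (S : Set (BinaryCubic ℤ)) (X : ℝ) : ℕ :=
  {O : Set (BinaryCubic ℤ) | ∃ f ∈ S, O = gl2zOrbit f ∧ f.IsIrreducible ∧ 0 < s * f.disc ∧
    ((s * f.disc : ℤ) : ℝ) < X}.ncard

/-- The discriminants in the real window `0 < s·D < X` form a finite set of nonzero integers, inside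
`discWindow s ⌈X⌉₊`. [folklore] -/
theorem mem_discWindow_ceil_of_window {s : ℤ} (hs : s = 1 ∨ s = -1) {X : ℝ} {D : ℤ} (h0 : 0 < s * D)
    (hX : ((s * D : ℤ) : ℝ) < X) : D ∈ discWindow s ⌈X⌉₊ := by
  rw [mem_discWindow hs]
  refine ⟨h0, ?_⟩
  have h1 : ((s * D : ℤ) : ℝ) < (⌈X⌉₊ : ℝ) := hX.trans_le (Nat.le_ceil X)
  exact_mod_cast h1

/-- The orbits counted by `irredOrbitCount s S X` are among the orbits with discriminant in
`discWindow s ⌈X⌉₊`. [folklore] -/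
theorem setOf_irredOrbit_subset {s : ℤ} (hs : s = 1 ∨ s = -1) (S : Set (BinaryCubic ℤ)) (X : ℝ) :
    {O : Set (BinaryCubic ℤ) | ∃ f ∈ S, O = gl2zOrbit f ∧ f.IsIrreducible ∧ 0 < s * f.disc ∧
      ((s * f.disc : ℤ) : ℝ) < X} ⊆ orbitsWith BinaryCubic.IsIrreducible (discWindow s ⌈X⌉₊ : Finset ℤ) := by
  rintro O ⟨f, -, rfl, hirr, h0, hX⟩
  exact ⟨f, rfl, hirr, by exact_mod_cast mem_discWindow_ceil_of_window hs h0 hX⟩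

/-- `0 ∉ discWindow s X`. [folklore] -/
theorem zero_not_mem_discWindow {s : ℤ} (hs : s = 1 ∨ s = -1) (X : ℕ) : (0 : ℤ) ∉ discWindow s X := by
  rw [mem_discWindow hs, mul_zero]
  exact fun h => lt_irrefl _ h.1

/-- The set of orbits counted is finite. [folklore] -/
theorem setOf_irredOrbit_finite {s : ℤ} (hs : s = 1 ∨ s = -1) (S : Set (BinaryCubic ℤ)) (X : ℝ) :
    {O : Set (BinaryCubic ℤ) | ∃ f ∈ S, O = gl2zOrbit f ∧ f.IsIrreducible ∧ 0 < s * f.disc ∧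
      ((s * f.disc : ℤ) : ℝ) < X}.Finite :=
  (orbitsWith_finite _ (discWindow s ⌈X⌉₊).finite_toSet
    (by exact_mod_cast zero_not_mem_discWindow hs ⌈X⌉₊)).subset (setOf_irredOrbit_subset hs S X)

/-- `N` only sees the window: `N(S; X) = N(S ∩ A_X; X)` with `A_X = {0 < s·Disc < X}`. [folklore] -/
theorem irredOrbitCount_inter_window (s : ℤ) (S : Set (BinaryCubic ℤ)) (X : ℝ) :
    irredOrbitCount s S X =
      irredOrbitCount s (S ∩ {f | 0 < s * f.disc ∧ ((s * f.disc : ℤ) : ℝ) < X}) X := by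
  unfold irredOrbitCount
  congr 1
  ext O
  constructor
  · rintro ⟨f, hS, hO, hirr, h0, hX⟩
    exact ⟨f, ⟨hS, h0, hX⟩, hO, hirr, h0, hX⟩
  · rintro ⟨f, ⟨hS, -, -⟩, hO, hirr, h0, hX⟩
    exact ⟨f, hS, hO, hirr, h0, hX⟩

/-- `N` is monotone in `S`. [folklore] -/
theorem irredOrbitCount_mono {s : ℤ} (hs : s = 1 ∨ s = -1) {S S' : Set (BinaryCubic ℤ)} (X : ℝ) (h : S ⊆ S') :
    irredOrbitCount s S X ≤ irredOrbitCount s S' X := by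
  refine Set.ncard_le_ncard ?_ (setOf_irredOrbit_finite hs S' X)
  rintro O ⟨f, hS, hO, hirr, h0, hX⟩
  exact ⟨f, h hS, hO, hirr, h0, hX⟩

/-- `N` is subadditive in `S`. [folklore] -/
theorem irredOrbitCount_union_le (s : ℤ) (S S' : Set (BinaryCubic ℤ)) (X : ℝ) :
    irredOrbitCount s (S ∪ S') X ≤ irredOrbitCount s S X + irredOrbitCount s S' X := by
  unfold irredOrbitCount
  refine le_trans (le_of_eq ?_) (Set.ncard_union_le _ _)
  congr 1
  ext O
  constructor
  · rintro ⟨f, hS | hS, hO, hirr, h0, hX⟩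
    · exact Or.inl ⟨f, hS, hO, hirr, h0, hX⟩
    · exact Or.inr ⟨f, hS, hO, hirr, h0, hX⟩
  · rintro (⟨f, hS, hO, hirr, h0, hX⟩ | ⟨f, hS, hO, hirr, h0, hX⟩)
    · exact ⟨f, Or.inl hS, hO, hirr, h0, hX⟩
    · exact ⟨f, Or.inr hS, hO, hirr, h0, hX⟩

/-- `N(∅; X) = 0`. [folklore] -/
theorem irredOrbitCount_empty (s : ℤ) (X : ℝ) : irredOrbitCount s ∅ X = 0 := by
  unfold irredOrbitCount
  convert Set.ncard_empty (Set (BinaryCubic ℤ))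
  ext O
  simp

/-! ### Irreducible forms have `|Disc| > 2` -/

/-- **An irreducible integral binary cubic form has `|Disc| > 2`** (in particular `Disc ≠ 1`):
`R(f)` embeds in a maximal irreducible `R(g) ≅ 𝓞 K` with `Disc f = N² Disc g = N² Disc K`, and
`|Disc K| > 2` by Minkowski (`NumberField.abs_discr_gt_two`). [folklore] -/
theorem BinaryCubic.IsIrreducible.two_lt_abs_disc {f : BinaryCubic ℤ} (hf : f.IsIrreducible) : 2 < |f.disc| := by
  have h0 := disc_ne_zero_of_isIrreducible hf
  obtain ⟨g, hg, φ, hφ⟩ := exists_isMaximal_overring h0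
  have hgirr : g.IsIrreducible := isIrreducible_of_injective hf φ hφ
  obtain ⟨K, _, _, h3, ⟨e⟩⟩ := isMaximal_and_isIrreducible_iff.mp ⟨hg, hgirr⟩
  have hdg : g.disc = discr K := disc_eq_discr_of_ringEquiv_ringOfIntegers h3 e
  have hK : 2 < |discr K| := NumberField.abs_discr_gt_two (by rw [h3]; norm_num)
  have hD : f.disc = detOnQuot φ ^ 2 * g.disc := disc_eq_detOnQuot_sq_mul φ hφ
  have hN : 1 ≤ |detOnQuot φ| := Int.one_le_abs (detOnQuot_ne_zero hφ)
  rw [hD, abs_mul, abs_pow, hdg]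
  calc (2 : ℤ) < |discr K| := hK
    _ = 1 ^ 2 * |discr K| := by ring
    _ ≤ |detOnQuot φ| ^ 2 * |discr K| := by
        gcongr

/-- So `Disc f ≠ 1` for irreducible `f`. [folklore] -/
theorem BinaryCubic.IsIrreducible.disc_ne_one {f : BinaryCubic ℤ} (hf : f.IsIrreducible) : f.disc ≠ 1 := by
  intro h
  have := hf.two_lt_abs_disc
  rw [h] at this
  norm_num at this

/-! ### `N(𝒱 ∩ V^{(i)}; X)` as a sum over fundamental discriminants -/

/-- The set `𝒱 = ∩_p 𝒱_p` in the tree's spelling: forms whose discriminant is locally fundamental at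
every prime (BST §8.2; Bhargava–Varma §3). [cite: BhargavaShankarTsimerman2012, §8.2 (𝒱_p; 𝒵_p = forms whose discriminant is not fundamental at p)] -/
theorem mem_iInter_isFundAt_iff (f : BinaryCubic ℤ) :
    f ∈ (⋂ p ∈ {p : ℕ | p.Prime}, {g : BinaryCubic ℤ | IsFundAt p g.disc}) ↔ ∀ p : ℕ, p.Prime → IsFundAt p f.disc := by
  simp only [Set.mem_iInter, Set.mem_setOf_eq]

/-- For an irreducible form: `Disc f` is a fundamental discriminant iff it is locally fundamental at every
prime (`isFundamental_iff_forall_isFundAt`; `Disc f ≠ 1` automatically). [folklore] -/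
theorem isFundamental_disc_iff_of_isIrreducible {f : BinaryCubic ℤ} (hf : f.IsIrreducible) :
    ((f.disc % 4 = 1 ∧ Squarefree f.disc ∧ f.disc ≠ 1) ∨
      (4 ∣ f.disc ∧ (f.disc / 4 % 4 = 2 ∨ f.disc / 4 % 4 = 3) ∧ Squarefree (f.disc / 4))) ↔
    ∀ p : ℕ, p.Prime → IsFundAt p f.disc := by
  rw [isFundamental_iff_forall_isFundAt]
  exact ⟨fun h => h.2, fun h => ⟨hf.disc_ne_one, h⟩⟩

/-- **`N(𝒱 ∩ V^{(1)}; X) = Σ_{D ∈ negFundDiscrs X} #irredOrbitsOfDisc D`** (`X ∈ ℕ`): the orbits of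
irreducible forms with everywhere-locally-fundamental discriminant in `(−X, 0)` are the orbits of
irreducible forms of discriminant `D`, `D` running over the negative fundamental discriminants `> −X`.
[cite: BhargavaShankarTsimerman2012, §8.5 (N(𝒱 ∩ V^{(1)}; X))] -/
theorem irredOrbitCount_fund_eq_sum_negFundDiscrs (X : ℕ) :
    irredOrbitCount (-1) (⋂ p ∈ {p : ℕ | p.Prime}, {g : BinaryCubic ℤ | IsFundAt p g.disc}) X =
      ∑ D ∈ negFundDiscrs X, Nat.card (irredOrbitsOfDisc D) := by
  have hset : {O : Set (BinaryCubic ℤ) | ∃ f ∈ (⋂ p ∈ {p : ℕ | p.Prime}, {g : BinaryCubic ℤ | IsFundAt p g.disc}),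
      O = gl2zOrbit f ∧ f.IsIrreducible ∧ 0 < (-1) * f.disc ∧ (((-1) * f.disc : ℤ) : ℝ) < (X : ℝ)} =
      orbitsWith BinaryCubic.IsIrreducible (negFundDiscrs X : Finset ℤ) := by
    ext O
    constructor
    · rintro ⟨f, hf, rfl, hirr, h0, hX⟩
      rw [mem_iInter_isFundAt_iff] at hf
      refine ⟨f, rfl, hirr, ?_⟩
      rw [Finset.mem_coe, mem_negFundDiscrs]
      have hX' : (-1) * f.disc < (X : ℤ) := by exact_mod_cast hX
      exact ⟨⟨by omega, by omega⟩, (isFundamental_disc_iff_of_isIrreducible hirr).2 hf⟩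
    · rintro ⟨f, rfl, hirr, hF⟩
      rw [Finset.mem_coe, mem_negFundDiscrs] at hF
      refine ⟨f, (mem_iInter_isFundAt_iff f).2 ((isFundamental_disc_iff_of_isIrreducible hirr).1 hF.2),
        rfl, hirr, by omega, ?_⟩
      have : (-1) * f.disc < (X : ℤ) := by omega
      exact_mod_cast this
  have h0 : (0 : ℤ) ∉ negFundDiscrs X := fun h => by
    have := (mem_negFundDiscrs.1 h).1.2; omega
  rw [irredOrbitCount, hset, ncard_orbitsWith_eq_sum _ _ h0]
  refine Finset.sum_congr rfl fun D _ => ?_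
  rw [orbitsWith_isIrreducible_singleton, Nat.card_coe_set_eq]

/-- **`N(𝒱 ∩ V^{(0)}; X) = Σ_{D ∈ posFundDiscrs X} #irredOrbitsOfDisc D`** (`X ∈ ℕ`).
[cite: BhargavaShankarTsimerman2012, §8.5 (N(𝒱 ∩ V^{(0)}; X))] -/
theorem irredOrbitCount_fund_eq_sum_posFundDiscrs (X : ℕ) :
    irredOrbitCount 1 (⋂ p ∈ {p : ℕ | p.Prime}, {g : BinaryCubic ℤ | IsFundAt p g.disc}) X =
      ∑ D ∈ posFundDiscrs X, Nat.card (irredOrbitsOfDisc D) := by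
  have hset : {O : Set (BinaryCubic ℤ) | ∃ f ∈ (⋂ p ∈ {p : ℕ | p.Prime}, {g : BinaryCubic ℤ | IsFundAt p g.disc}),
      O = gl2zOrbit f ∧ f.IsIrreducible ∧ 0 < 1 * f.disc ∧ ((1 * f.disc : ℤ) : ℝ) < (X : ℝ)} =
      orbitsWith BinaryCubic.IsIrreducible (posFundDiscrs X : Finset ℤ) := by
    ext O
    constructor
    · rintro ⟨f, hf, rfl, hirr, h0, hX⟩
      rw [mem_iInter_isFundAt_iff] at hf
      refine ⟨f, rfl, hirr, ?_⟩
      rw [Finset.mem_coe, mem_posFundDiscrs]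
      have hX' : 1 * f.disc < (X : ℤ) := by exact_mod_cast hX
      exact ⟨⟨by omega, by omega⟩, (isFundamental_disc_iff_of_isIrreducible hirr).2 hf⟩
    · rintro ⟨f, rfl, hirr, hF⟩
      rw [Finset.mem_coe, mem_posFundDiscrs] at hF
      refine ⟨f, (mem_iInter_isFundAt_iff f).2 ((isFundamental_disc_iff_of_isIrreducible hirr).1 hF.2),
        rfl, hirr, by omega, ?_⟩
      have : 1 * f.disc < (X : ℤ) := by omega
      exact_mod_cast this
  have h0 : (0 : ℤ) ∉ posFundDiscrs X := fun h => by
    have := (mem_posFundDiscrs.1 h).1.1; omega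
  rw [irredOrbitCount, hset, ncard_orbitsWith_eq_sum _ _ h0]
  refine Finset.sum_congr rfl fun D _ => ?_
  rw [orbitsWith_isIrreducible_singleton, Nat.card_coe_set_eq]

/-! ### Prop. 23 from the uniformity fact: `N(𝒵_p ∩ V^{(i)}; X) ≤ C' X/p²` -/

/-- A discriminant NOT locally fundamental at `p` is divisible by `p²` (at `p = 2`: a binary cubic
discriminant is `≡ 0, 1 (mod 4)`, and "not `≡ 1 (mod 4)`, not `≡ 8, 12 (mod 16)`" leaves `4 ∣ Disc`). [folklore] -/
theorem sq_dvd_disc_of_not_isFundAt {p : ℕ} (hp : p.Prime) {f : BinaryCubic ℤ} (h : ¬ IsFundAt p f.disc) :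
    (p : ℤ) ^ 2 ∣ f.disc := by
  by_cases hp2 : p = 2
  · subst hp2
    rw [isFundAt_two] at h
    push Not at h
    have h22 : (((2 : ℕ) : ℤ)) ^ 2 = 4 := by norm_num
    rcases disc_emod_four f with h4 | h4
    · rw [h22]; exact Int.dvd_of_emod_eq_zero h4
    · exact absurd h4 h.1
  · rwa [isFundAt_of_ne_two hp2, not_not] at h

/-- **`N(𝒵_p ∩ V^{(i)}; X) ≤ Σ_{D ∈ discWindow s ⌈X⌉₊, p² ∣ D} h(D)`**: the irreducible orbits not locally
fundamental at `p` in the window are among ALL orbits with `p² ∣ Disc` and `0 < s·Disc < ⌈X⌉₊`, counted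
with the class numbers `h(D) = classNumber D` of BTT (22). [folklore] -/
theorem irredOrbitCount_compl_isFundAt_le_sum {s : ℤ} (hs : s = 1 ∨ s = -1) {p : ℕ} (hp : p.Prime) (X : ℝ) :
    (irredOrbitCount s ({g : BinaryCubic ℤ | IsFundAt p g.disc}ᶜ) X : ℝ) ≤
      ((∑ D ∈ (discWindow s ⌈X⌉₊).filter (fun D => (p : ℤ) ^ 2 ∣ D), classNumber D : ℕ) : ℝ) := by
  classical
  have h0 : (0 : ℤ) ∉ (discWindow s ⌈X⌉₊).filter (fun D => (p : ℤ) ^ 2 ∣ D) := fun h =>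
    zero_not_mem_discWindow hs _ (Finset.mem_filter.1 h).1
  have hsum : ((orbitsWith (fun _ => True) (((discWindow s ⌈X⌉₊).filter (fun D => (p : ℤ) ^ 2 ∣ D) : Finset ℤ) : Set ℤ)).ncard)
      = ∑ D ∈ (discWindow s ⌈X⌉₊).filter (fun D => (p : ℤ) ^ 2 ∣ D), classNumber D := by
    rw [ncard_orbitsWith_eq_sum _ _ h0]
    refine Finset.sum_congr rfl fun D _ => ?_
    rw [orbitsWith_true_singleton, classNumber, Nat.card_coe_set_eq]
  have hle : irredOrbitCount s ({g : BinaryCubic ℤ | IsFundAt p g.disc}ᶜ) X ≤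
      (orbitsWith (fun _ => True) (((discWindow s ⌈X⌉₊).filter (fun D => (p : ℤ) ^ 2 ∣ D) : Finset ℤ) : Set ℤ)).ncard := by
    refine Set.ncard_le_ncard ?_ (orbitsWith_finite _ (Finset.finite_toSet _) (by exact_mod_cast h0))
    rintro O ⟨f, hf, rfl, -, h0', hX⟩
    refine ⟨f, rfl, trivial, ?_⟩
    rw [Finset.mem_coe, Finset.mem_filter]
    exact ⟨mem_discWindow_ceil_of_window hs h0' hX, sq_dvd_disc_of_not_isFundAt hp hf⟩
  rw [← hsum]
  exact_mod_cast hle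

/-- **Prop. 23 (the part used for Cor. 7), from the uniformity fact**: assuming `btt_uniformity_sqDvd`
(BTT Prop. 4.5) there is `C'` such that for every prime `p` and every real `X ≥ 1`,
`N(𝒵_p ∩ V^{(i)}; X) ≤ C' X/p²` (both signs). [cite: BhargavaShankarTsimerman2012, Proposition 23] -/
theorem exists_irredOrbitCount_compl_isFundAt_le (hU : btt_uniformity_sqDvd) :
    ∃ C' : ℝ, ∀ s : ℤ, (s = 1 ∨ s = -1) → ∀ p : ℕ, p.Prime → ∀ X : ℝ, 1 ≤ X →
      (irredOrbitCount s ({g : BinaryCubic ℤ | IsFundAt p g.disc}ᶜ) X : ℝ) ≤ C' * X / (p : ℝ) ^ 2 := by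
  obtain ⟨C, hC⟩ := hU
  refine ⟨12 * max C 0, fun s hs p hp X hX => ?_⟩
  have hsqf : Squarefree p := hp.prime.squarefree
  have hω : p.primeFactors.card = 1 := by rw [Nat.Prime.primeFactors hp, Finset.card_singleton]
  have h1 := hC p hsqf s hs ⌈X⌉₊
  rw [hω, pow_one] at h1
  have hceil : (⌈X⌉₊ : ℝ) ≤ 2 * X := by
    have := Nat.ceil_lt_add_one (zero_le_one.trans hX)
    linarith
  calc (irredOrbitCount s ({g : BinaryCubic ℤ | IsFundAt p g.disc}ᶜ) X : ℝ)
      ≤ ((∑ D ∈ (discWindow s ⌈X⌉₊).filter (fun D => (p : ℤ) ^ 2 ∣ D), classNumber D : ℕ) : ℝ) :=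
        irredOrbitCount_compl_isFundAt_le_sum hs hp X
    _ ≤ C * 6 * ⌈X⌉₊ / (p : ℝ) ^ 2 := h1
    _ ≤ max C 0 * 6 * ⌈X⌉₊ / (p : ℝ) ^ 2 := by
        gcongr
        exact le_max_left _ _
    _ ≤ max C 0 * 6 * (2 * X) / (p : ℝ) ^ 2 := by
        gcongr
    _ = 12 * max C 0 * X / (p : ℝ) ^ 2 := by ring

/-! ### The sieve: `N(𝒱 ∩ V^{(i)}; X)/X → c · (6/π²)²` -/

/-- **BST §8.5 / §8.3 — the sieve to fundamental discriminants.** Fix a sign `s`. Suppose that for every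
`Y` the finite-level count satisfies `N(∩_{p<Y} 𝒱_p ∩ V^{(i)}; X)/X → c · ∏_{p<Y} (1 − p⁻²)²` as `X → ∞`
(BST (ramanujan) = Thm 20 with `μ(𝒱_p) = (1 − p⁻²)²`, Lemma 13 — the HYPOTHESIS `hlevel`), and that the
uniformity estimate `btt_uniformity_sqDvd` (BTT Prop. 4.5 ⊇ BST Prop. 23) holds. Then
`N(𝒱 ∩ V^{(i)}; X)/X → c · (6/π²)²` (`∏_p (1 − p⁻²) = 1/ζ(2) = 6/π²`). The sieve is the tree's
`tendsto_count_iInter_prime_div`; below height `X` only primes `p ≤ X + 2` can fail (`isFundAt_of_sq_lt`).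
[cite: BhargavaShankarTsimerman2012, §8.5 with §8.3 (limsup/liminf sieve, Y → ∞)] -/
theorem tendsto_irredOrbitCount_fund_div {s : ℤ} (hs : s = 1 ∨ s = -1) {c : ℝ}
    (hlevel : ∀ Y : ℕ, Tendsto (fun X : ℝ =>
      (irredOrbitCount s (⋂ p ∈ (Finset.range Y).filter Nat.Prime, {g : BinaryCubic ℤ | IsFundAt p g.disc}) X : ℝ) / X)
      atTop (𝓝 (c * ∏ p ∈ (Finset.range Y).filter Nat.Prime, (1 - 1 / (p : ℝ) ^ 2) ^ 2)))
    (hU : btt_uniformity_sqDvd) :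
    Tendsto (fun X : ℝ =>
      (irredOrbitCount s (⋂ p ∈ {p : ℕ | p.Prime}, {g : BinaryCubic ℤ | IsFundAt p g.disc}) X : ℝ) / X)
      atTop (𝓝 (c * (6 / Real.pi ^ 2) ^ 2)) := by
  obtain ⟨C', hC'⟩ := exists_irredOrbitCount_compl_isFundAt_le hU
  have hprod : HasProd (fun p : Nat.Primes => (1 - 1 / ((p : ℕ) : ℝ) ^ 2) ^ 2) ((6 / Real.pi ^ 2) ^ 2) := by
    have h := hasProd_one_sub_one_div_prime_sq.mul hasProd_one_sub_one_div_prime_sq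
    simp only [← sq] at h
    exact h
  have key := tendsto_count_iInter_prime_div (α := BinaryCubic ℤ)
    (fun S X => (irredOrbitCount s S X : ℝ)) Set.univ
    (fun p => {g : BinaryCubic ℤ | IsFundAt p g.disc})
    (fun X => {f : BinaryCubic ℤ | 0 < s * f.disc ∧ ((s * f.disc : ℤ) : ℝ) < X})
    (μ := fun p => (1 - 1 / (p : ℝ) ^ 2) ^ 2) (c := c) (M := (6 / Real.pi ^ 2) ^ 2) (C := C') (X₀ := 1)
    (fun S X => by exact_mod_cast irredOrbitCount_inter_window s S X)
    (fun S S' X h => by exact_mod_cast irredOrbitCount_mono hs X h)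
    (fun S S' X => by exact_mod_cast irredOrbitCount_union_le s S S' X)
    (fun X => by exact_mod_cast irredOrbitCount_empty s X)
    ?_ ?_ hprod ?_
  · simpa only [Set.univ_inter] using key
  · -- only primes `p ≤ X + 2` can fail inside the window
    intro X
    refine ⟨⌈X⌉₊ + 3, fun p hp hBp f hf => ?_⟩
    obtain ⟨-, h0, hX⟩ := hf
    have hp2 : p ≠ 2 := by omega
    have hD0 : f.disc ≠ 0 := by
      rintro h; rw [h, mul_zero] at h0; exact lt_irrefl _ h0
    refine isFundAt_of_sq_lt hp2 hD0 ?_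
    have habs : |f.disc| = s * f.disc := by
      rcases hs with rfl | rfl
      · rw [one_mul] at h0 ⊢; exact abs_of_pos h0
      · rw [neg_one_mul] at h0 ⊢; exact abs_of_neg (by omega)
    have h1 : ((s * f.disc : ℤ) : ℝ) < (⌈X⌉₊ : ℝ) := hX.trans_le (Nat.le_ceil X)
    have h2 : s * f.disc < (⌈X⌉₊ : ℤ) := by exact_mod_cast h1
    have h3 : (⌈X⌉₊ : ℤ) + 3 ≤ p := by exact_mod_cast hBp
    calc |f.disc| = s * f.disc := habs
      _ < (⌈X⌉₊ : ℤ) := h2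
      _ < (p : ℤ) := by omega
      _ ≤ (p : ℤ) ^ 2 := Int.le_self_sq _
  · intro Y
    simpa only [Set.univ_inter] using hlevel Y
  · intro p hp X hX
    simpa only [Set.univ_inter] using hC' s hs p hp X hX

/-! ### The assembly with the finite-level counts as the only analytic hypothesis -/

/-- `(π²/24) · (6/π²)² = 3/(2π²)` and `(π²/72) · (6/π²)² = 1/(2π²)` (`(π²/(12nᵢ)) ∏_p (1−p⁻²)² = 3/(nᵢπ²)`,
`n₁ = 2`, `n₀ = 6`). [cite: BhargavaShankarTsimerman2012, §8.5 (display: = 3/(nᵢπ²))] -/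
theorem bst_cor7_constants :
    Real.pi ^ 2 / 24 * (6 / Real.pi ^ 2) ^ 2 = 3 / (2 * Real.pi ^ 2) ∧
      Real.pi ^ 2 / 72 * (6 / Real.pi ^ 2) ^ 2 = 1 / (2 * Real.pi ^ 2) := by
  have hπ : (Real.pi ^ 2 : ℝ) ≠ 0 := by positivity
  constructor <;> field_simp <;> ring

/-- **Davenport–Heilbronn's first-order `3`-torsion sums (`davenportHeilbronn_threeTorsion_sum_asymp`,
BST Cor. 7 / §8.5) from: the dictionary, the uniformity fact, and the finite-level Davenport counts.**
Hypotheses: `hdict` — `#Cl₃(D) = 2·#{cubic fields of disc D} + 1` on fundamental `D` (class field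
theory; named fact `threeTorsion_eq_two_mul_cubicFieldCountOfDisc_add_one`); `hU` — `btt_uniformity_sqDvd`
(BTT Prop. 4.5, giving BST Prop. 23); `hneg`/`hpos` — for every `Y`,
`N(∩_{p<Y} 𝒱_p ∩ V^{(1)}; X)/X → (π²/24) ∏_{p<Y} (1 − p⁻²)²` and
`N(∩_{p<Y} 𝒱_p ∩ V^{(0)}; X)/X → (π²/72) ∏_{p<Y} (1 − p⁻²)²` (BST (ramanujan): Thm 20 with Lemma 13,
`π²/(12nᵢ)` with `n₁ = 2`, `n₀ = 6` — Davenport's theorem with congruence conditions, the one input of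
the printed proof not in the tree). Conclusion: `Σ_{-X<D<0} #Cl₃(D)/X → 6/π²`, `Σ_{0<D<X} #Cl₃(D)/X → 4/π²`.
[cite: BhargavaShankarTsimerman2012, §8.5 (proof of Cor. 7)] -/
theorem davenportHeilbronn_threeTorsion_sum_asymp_of_level_counts
    (hdict : ∀ D : ℤ, ((D % 4 = 1 ∧ Squarefree D ∧ D ≠ 1) ∨
      (4 ∣ D ∧ (D / 4 % 4 = 2 ∨ D / 4 % 4 = 3) ∧ Squarefree (D / 4))) →
      quadFieldThreeTorsion D = 2 * cubicFieldCountOfDisc D + 1) (hU : btt_uniformity_sqDvd)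
    (hneg : ∀ Y : ℕ, Tendsto (fun X : ℝ =>
      (irredOrbitCount (-1) (⋂ p ∈ (Finset.range Y).filter Nat.Prime, {g : BinaryCubic ℤ | IsFundAt p g.disc}) X : ℝ) / X)
      atTop (𝓝 (Real.pi ^ 2 / 24 * ∏ p ∈ (Finset.range Y).filter Nat.Prime, (1 - 1 / (p : ℝ) ^ 2) ^ 2)))
    (hpos : ∀ Y : ℕ, Tendsto (fun X : ℝ =>
      (irredOrbitCount 1 (⋂ p ∈ (Finset.range Y).filter Nat.Prime, {g : BinaryCubic ℤ | IsFundAt p g.disc}) X : ℝ) / X)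
      atTop (𝓝 (Real.pi ^ 2 / 72 * ∏ p ∈ (Finset.range Y).filter Nat.Prime, (1 - 1 / (p : ℝ) ^ 2) ^ 2))) :
    davenportHeilbronn_threeTorsion_sum_asymp := by
  have h1 := (tendsto_irredOrbitCount_fund_div (Or.inr rfl) hneg hU).comp tendsto_natCast_atTop_atTop
  have h2 := (tendsto_irredOrbitCount_fund_div (Or.inl rfl) hpos hU).comp tendsto_natCast_atTop_atTop
  rw [bst_cor7_constants.1] at h1
  rw [bst_cor7_constants.2] at h2
  refine davenportHeilbronn_threeTorsion_sum_asymp_of_irredOrbitCount hdict (h1.congr fun X => ?_)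
    (h2.congr fun X => ?_)
  · simp only [Function.comp_apply, irredOrbitCount_fund_eq_sum_negFundDiscrs, Nat.cast_sum]
  · simp only [Function.comp_apply, irredOrbitCount_fund_eq_sum_posFundDiscrs, Nat.cast_sum]

end Literature.NumberTheory.CubicFields

end
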